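import Summits.QuantumFields.BalabanUV.Beta.GAN24.FibreArrow

/-!
# `BalabanUV.Beta.GAN24.Capacitance` — binder row G-an2-4 / (CONV-C), road P1-fibre, node N07 of `SKELETON-P1.md` (leaf P1-L05, PART (b)):
# the capacitance MATRIX of the alias fibre, its invertibility at real quasi-momentum, and the BORDERED-INVERSE FORMULA for `fibreMatrix (blochChar p)`

NOT IN PRINT; OUR PROOF ATTEMPT.  HONEST FRAMING (cell contract, verbatim): «discharging `BetaPertH` makes Bałaban's UV stability UNCONDITIONAL — a real
constructive-QFT result; it is NOT the continuum limit and NOT the Clay problem.»  HONEST DEPENDENCY (verbatim): «continuum YM on T⁴ ⇐ BetaPertH ∧ nine spine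
estimates (0/9 proved); BetaPertH ⇐ (D1) ∧ (D4) ∧ CAP+tail; G-an2-4 gates asym, D1 and NE2/3/4.»  [folklore] finite-dimensional linear algebra over `ℂ` (no estimate,
no cited fact, no wall binder, no `def … : Prop` fact).  NOT summit progress; nothing of (CONV-C)'s K-slot is discharged here.

## What is proved
§1–§2 for ANY fibre data `F : CapacitanceSolve.Fibre D ι` (leaf-15): the `(D+1)×(D+1)` CAPACITANCE MATRIX `capMat F = [[capP, capV],[capW, 0]]` on `Fin D ⊕ Unit`,
`capSolves_iff_mulVec` (`CapSolves F f γ ρ q φ c ↔ capMat F *ᵥ (φ;c) = (q − srcQ; −ρ − srcM)`), the vanishing of the sources at zero data (`srcQ_zero`, `srcM_zero`),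
and `isUnit_capMat_of_injective`: trivial homogeneous kernel ⇒ `IsUnit (capMat F)`.
§3–§4 for the ALIAS FIBRE `F = FibreArrow.aliasFibre p hL` of a UNITARY Bloch character (`hχ : ∀ a, ‖blochChar p a‖ = 1`, i.e. real `p`; `hL : ∀ m, L_m ≠ 0`, i.e.
`p ∉ 2πℤ^D`): `synthVec` (box data from amplitudes, inverse of `ampA`/`ampμ` by `FibreDFT.amp_synth`), `amp_zero'`, `srcEL_zero`, `srcG_zero`;
**`cap_injective`** — the homogeneous capacitance system has only the trivial solution (an2's `BlochFibreMatrix.eq_zero_of_fibreLin_eq_zero` pulled through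
`FibreArrow.fibreFun_eq_iff_arrowSolves` and leaf-15's `arrow_injective_iff_cap_injective`; the gauge constant dies by `synth p χ̂ = 1`); **`isUnit_capMat`**;
**`cap_solution`** — for every `v`, with `r := fibreFun (blochChar p) v`, the pair `(φ, c) := (v∘inr∘inr, Γ(0))` solves the capacitance system with the sources of `r`
and the amplitudes ARE the per-alias formulas: `ampA p v = Ablk F (srcEL p r) (srcG p r) φ c`, `ampμ p v = mublk F (srcEL p r) φ`; **`bordered_inverse`** — hence
`v (inl (κ,z)) = Σ_m Ablk … m κ · pw k_m (repZ z)`, `v (inr (inl z)) = Σ_m mublk … m · pw k_m (repZ z)` (leaf-16's `boxData_inl/inr_eq_sum`): the solution of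
`fibreMatrix (blochChar p) *ᵥ v = r` is EXPLICIT modulo the `(D+1)×(D+1)` inverse `(capMat F)⁻¹` — S1b/S1b′ of `SKELETON-P1.md` («arrowMat_inv_apply»), the object
whose `N`-uniform endpoint bounds are leaf P1-L08.  The `p = 0` fibre (`CapacitanceSolveZero.Fibre0`) is not packaged here.
Unit `b2b-balaban-gan24-formalise-leaf-06` (G-an2-4 formalisation swarm), 2026-08-19.
-/

noncomputable section

open Complex Finset
open scoped BigOperators
open Literature.MathematicalPhysics.QuantumFieldTheory.Balaban1983to89.Beta
open Literature.MathematicalPhysics.QuantumFieldTheory.LatticeForm (repZ)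
open Literature.Probability.LatticeModels (TorusSite)
open AffineAveraging (Site)
open BlochFibreMatrix (Idx blochChar fibreFun fibreLin fibreLin_apply eq_zero_of_fibreLin_eq_zero)
open Summit.QuantumFields.BalabanUV.Beta.GAN24.FibreSymbols (pw lapSym)
open Summit.QuantumFields.BalabanUV.Beta.GAN24.FibreBlockSolve (dot)
open Summit.QuantumFields.BalabanUV.Beta.GAN24.FibreDFT (kFine amp synth synth_amp amp_synth pw_zero_site)
open Summit.QuantumFields.BalabanUV.Beta.GAN24.FibreDFTDictionary (ampA ampμ boxData_inl_eq_sum boxData_inr_eq_sum)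
open Summit.QuantumFields.BalabanUV.Beta.GAN24.CapacitanceSolve
  (Fibre ArrowSolves ELRows GRows MRow QRows CapSolves capP capV capW srcQ srcM Ablk mublk arrowSolves_iff arrow_of_cap cap_of_arrow
    arrow_injective_iff_cap_injective)
open Summit.QuantumFields.BalabanUV.Beta.GAN24.FibreArrow (chiHat srcEL rG srcG aliasFibre synth_chiHat synth_zero fibreFun_eq_iff_arrowSolves)

namespace Summit.QuantumFields.BalabanUV.Beta.GAN24.Capacitance

/-! ## §1 The capacitance matrix of an abstract fibre -/

section Abstract

variable {D : ℕ} {ι : Type*} [Fintype ι] (F : Fibre D ι)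

/-- [folklore] THE CAPACITANCE MATRIX `[[capP, capV],[capW, 0]]` of S1b′ on the index `Fin D ⊕ Unit` (constraint multipliers `φ`, gauge constant `c`). -/
def capMat : Matrix (Fin D ⊕ Unit) (Fin D ⊕ Unit) ℂ :=
  Matrix.fromBlocks (Matrix.of fun κ l => capP F κ l) (Matrix.of fun κ _ => capV F κ) (Matrix.of fun _ l => capW F l) 0

/-- [folklore] The unknown vector `(φ; c)`. -/
def capVec (φ : Fin D → ℂ) (c : ℂ) : Fin D ⊕ Unit → ℂ := Sum.elim φ fun _ => c

/-- [folklore] The right-hand side `(q − srcQ; −ρ − srcM)`. -/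
def capRhs (f : ι → Fin D → ℂ) (γ : ι → ℂ) (ρ : ℂ) (q : Fin D → ℂ) : Fin D ⊕ Unit → ℂ :=
  Sum.elim (fun κ => q κ - srcQ F f γ κ) fun _ => -ρ - srcM F f

/-- [folklore] `capMat *ᵥ (φ; c)` componentwise. -/
theorem capMat_mulVec_capVec (φ : Fin D → ℂ) (c : ℂ) :
    (capMat F).mulVec (capVec φ c) = Sum.elim (fun κ => ∑ l, capP F κ l * φ l + capV F κ * c) fun _ => ∑ l, capW F l * φ l := by
  unfold capMat capVec
  rw [Matrix.fromBlocks_mulVec]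
  congr 1
  · funext κ
    simp [Matrix.mulVec, dotProduct]
  · funext u
    simp [Matrix.mulVec, dotProduct]

/-- [folklore] **`CapSolves` IS THE LINEAR SYSTEM `capMat *ᵥ (φ; c) = capRhs`.** -/
theorem capSolves_iff_mulVec (f : ι → Fin D → ℂ) (γ : ι → ℂ) (ρ : ℂ) (q : Fin D → ℂ) (φ : Fin D → ℂ) (c : ℂ) :
    CapSolves F f γ ρ q φ c ↔ (capMat F).mulVec (capVec φ c) = capRhs F f γ ρ q := by
  rw [capMat_mulVec_capVec]
  unfold CapSolves capRhs
  constructor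
  · rintro ⟨hQ, hM⟩
    refine Sum.elim_eq_iff.mpr ⟨funext hQ, funext fun _ => hM⟩  -- both components
  · intro h
    have h' := Sum.elim_eq_iff.mp h
    exact ⟨fun κ => congrFun h'.1 κ, congrFun h'.2 ()⟩

/-- [folklore] The Q source vanishes at zero data. -/
theorem srcQ_zero (κ : Fin D) : srcQ F 0 0 κ = 0 := by
  simp [srcQ, dot]

/-- [folklore] The M source vanishes at zero data. -/
theorem srcM_zero : srcM F 0 = 0 := by
  simp [srcM, dot]

/-- [folklore] `capRhs F 0 0 0 0 = 0`. -/
theorem capRhs_zero : capRhs F 0 0 0 0 = 0 := by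
  funext i
  rcases i with κ | u
  · simp [capRhs, srcQ_zero]
  · simp [capRhs, srcM_zero]

/-- [folklore] Every vector on `Fin D ⊕ Unit` is a `capVec`. -/
theorem capVec_eta (x : Fin D ⊕ Unit → ℂ) : capVec (fun κ => x (Sum.inl κ)) (x (Sum.inr ())) = x := by
  funext i; rcases i with κ | u
  · rfl
  · rfl

/-- [folklore] **INJECTIVE ⇒ INVERTIBLE** for the square capacitance matrix: if the homogeneous capacitance system has only the trivial solution then
`capMat F` is a unit (so `(capMat F)⁻¹` is a two-sided inverse). -/
theorem isUnit_capMat_of_injective (h : ∀ φ c, CapSolves F 0 0 0 0 φ c → φ = 0 ∧ c = 0) : IsUnit (capMat F) := by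
  rw [← Matrix.mulVec_injective_iff_isUnit]
  intro x y hxy
  have hsub : (capMat F).mulVec (x - y) = 0 := by rw [Matrix.mulVec_sub, hxy, sub_self]
  set φ : Fin D → ℂ := fun κ => (x - y) (Sum.inl κ) with hφ
  set c : ℂ := (x - y) (Sum.inr ()) with hc
  have hcap : CapSolves F 0 0 0 0 φ c := by
    rw [capSolves_iff_mulVec, capRhs_zero, capVec_eta]
    exact hsub
  obtain ⟨hφ0, hc0⟩ := h φ c hcap
  have : x - y = 0 := by
    rw [← capVec_eta (x - y)]
    funext i; rcases i with κ | u
    · exact congrFun hφ0 κ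
    · exact hc0
  exact sub_eq_zero.mp this

end Abstract

/-! ## §2 Box data from amplitudes (the inverse dictionary as a map) -/

section Alias

variable {D N : ℕ} [NeZero N]

/-- [folklore] BOX DATA FROM AMPLITUDES: synthesise `A`-amplitudes and `μ`-amplitudes, keep `φ`. -/
def synthVec (p : Fin D → ℂ) (A : TorusSite D N → Fin D → ℂ) (μ : TorusSite D N → ℂ) (φ : Fin D → ℂ) : Idx D N → ℂ
  | Sum.inl (κ, z) => synth p (fun m => A m κ) z
  | Sum.inr (Sum.inl z) => synth p μ z
  | Sum.inr (Sum.inr κ) => φ κ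

/-- [folklore] `ampA ∘ synthVec = A`. -/
theorem ampA_synthVec (p : Fin D → ℂ) (A : TorusSite D N → Fin D → ℂ) (μ : TorusSite D N → ℂ) (φ : Fin D → ℂ) :
    ampA p (synthVec p A μ φ) = A := by
  funext m κ
  have h := congrFun (amp_synth p (fun m => A m κ)) m
  exact h

/-- [folklore] `ampμ ∘ synthVec = μ`. -/
theorem ampμ_synthVec (p : Fin D → ℂ) (A : TorusSite D N → Fin D → ℂ) (μ : TorusSite D N → ℂ) (φ : Fin D → ℂ) :
    ampμ p (synthVec p A μ φ) = μ := by
  funext m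
  have h := congrFun (amp_synth p μ) m
  exact h

/-- [folklore] The `φ`-slot of `synthVec`. -/
theorem synthVec_inr_inr (p : Fin D → ℂ) (A : TorusSite D N → Fin D → ℂ) (μ : TorusSite D N → ℂ) (φ : Fin D → ℂ) (κ : Fin D) :
    synthVec p A μ φ (Sum.inr (Sum.inr κ)) = φ κ := rfl

/-- [folklore] The twisted box DFT of `0` is `0`. -/
theorem amp_zero' (p : Fin D → ℂ) (m : TorusSite D N) : amp p (0 : TorusSite D N → ℂ) m = 0 := by
  simp [amp]

/-- [folklore] Zero EL source. -/
theorem srcEL_zero (p : Fin D → ℂ) : srcEL p (0 : Idx D N → ℂ) = 0 := by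
  funext m κ
  exact amp_zero' p m

/-- [folklore] Zero G source. -/
theorem srcG_zero (p : Fin D → ℂ) : srcG p (0 : Idx D N → ℂ) = 0 := by
  funext m
  unfold srcG
  have : rG (0 : Idx D N → ℂ) = 0 := by funext z; simp [rG]
  rw [this]
  exact amp_zero' p m

/-! ## §3 Invertibility of the capacitance matrix of the alias fibre (unitary character) -/

/-- [folklore] If `χ̂_m · c = 0` for every alias then `c = 0` (because `Σ_m χ̂_m = synth p χ̂ 0 = 1`). -/
theorem eq_zero_of_chiHat_mul (p : Fin D → ℂ) {c : ℂ} (h : ∀ m : TorusSite D N, chiHat p m * c = 0) : c = 0 := by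
  have h1 : synth p (chiHat (N := N) p) 0 = 1 := synth_chiHat p 0
  rw [synth_zero] at h1
  calc c = (∑ m : TorusSite D N, chiHat p m) * c := by rw [h1, one_mul]
    _ = ∑ m : TorusSite D N, chiHat p m * c := Finset.sum_mul _ _ _
    _ = 0 := Finset.sum_eq_zero fun m _ => h m

/-- [folklore] **THE HOMOGENEOUS ARROW SYSTEM OF THE ALIAS FIBRE IS TRIVIAL** for a unitary Bloch character: an2's injectivity of the fibre map, read in
box-DFT coordinates. -/
theorem arrow_injective (p : Fin D → ℂ) (hχ : ∀ a, ‖blochChar p a‖ = 1) (hL : ∀ m : TorusSite D N, lapSym (kFine p m) ≠ 0)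
    (A : TorusSite D N → Fin D → ℂ) (μ : TorusSite D N → ℂ) (φ : Fin D → ℂ) (c : ℂ)
    (h : ArrowSolves (aliasFibre p hL) 0 0 0 0 A μ φ c) : A = 0 ∧ μ = 0 ∧ φ = 0 ∧ c = 0 := by
  set v : Idx D N → ℂ := synthVec p A μ φ with hv
  have hA : ampA p v = A := ampA_synthVec p A μ φ
  have hμ : ampμ p v = μ := ampμ_synthVec p A μ φ
  -- the fibre system with zero right-hand side holds for `v`
  have hsys : fibreFun (⇑(blochChar p)) v = 0 := by
    rw [fibreFun_eq_iff_arrowSolves p hL v 0]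
    refine ⟨c, ?_⟩
    rw [srcEL_zero, srcG_zero, hA, hμ]
    exact h
  have hv0 : v = 0 := eq_zero_of_fibreLin_eq_zero (blochChar p) hχ (by rw [fibreLin_apply]; exact hsys)
  have hA0 : A = 0 := by
    rw [← hA, hv0]; funext m κ; exact amp_zero' p m
  have hμ0 : μ = 0 := by
    rw [← hμ, hv0]; funext m; exact amp_zero' p m
  have hφ0 : φ = 0 := by
    funext κ
    have := congrFun hv0 (Sum.inr (Sum.inr κ))
    exact this
  refine ⟨hA0, hμ0, hφ0, ?_⟩
  -- the gauge constant: G rows with `A = 0`, `γ = 0` give `χ̂_m c = 0` for all `m`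
  obtain ⟨_, hG, _, _⟩ := h
  refine eq_zero_of_chiHat_mul (N := N) p fun m => ?_
  have hm := hG m
  rw [hA0] at hm
  simp only [aliasFibre, Pi.zero_apply, dot, mul_zero, Finset.sum_const_zero, zero_sub, neg_eq_zero] at hm
  exact hm

/-- [folklore] **THE HOMOGENEOUS CAPACITANCE SYSTEM IS TRIVIAL** (real quasi-momentum off `2πℤ^D`). -/
theorem cap_injective (p : Fin D → ℂ) (hχ : ∀ a, ‖blochChar p a‖ = 1) (hL : ∀ m : TorusSite D N, lapSym (kFine p m) ≠ 0)
    (φ : Fin D → ℂ) (c : ℂ) (h : CapSolves (aliasFibre p hL) 0 0 0 0 φ c) : φ = 0 ∧ c = 0 :=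
  (arrow_injective_iff_cap_injective (aliasFibre p hL)).mp (arrow_injective p hχ hL) φ c h

/-- [folklore] **THE CAPACITANCE MATRIX IS INVERTIBLE** at every real quasi-momentum off `2πℤ^D`. -/
theorem isUnit_capMat (p : Fin D → ℂ) (hχ : ∀ a, ‖blochChar p a‖ = 1) (hL : ∀ m : TorusSite D N, lapSym (kFine p m) ≠ 0) :
    IsUnit (capMat (aliasFibre p hL)) :=
  isUnit_capMat_of_injective _ (cap_injective p hχ hL)

/-- [folklore] Uniqueness of the capacitance solution for given sources. -/
theorem cap_unique (p : Fin D → ℂ) (hχ : ∀ a, ‖blochChar p a‖ = 1) (hL : ∀ m : TorusSite D N, lapSym (kFine p m) ≠ 0)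
    {f : TorusSite D N → Fin D → ℂ} {γ : TorusSite D N → ℂ} {ρ : ℂ} {q : Fin D → ℂ} {φ φ' : Fin D → ℂ} {c c' : ℂ}
    (h : CapSolves (aliasFibre p hL) f γ ρ q φ c) (h' : CapSolves (aliasFibre p hL) f γ ρ q φ' c') : φ = φ' ∧ c = c' := by
  have hinj := Matrix.mulVec_injective_iff_isUnit.mpr (isUnit_capMat p hχ hL)
  rw [capSolves_iff_mulVec] at h h'
  have := hinj (h.trans h'.symm)
  have hc := Sum.elim_eq_iff.mp this
  exact ⟨hc.1, congrFun hc.2 ()⟩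

/-! ## §4 The bordered-inverse formula -/

/-- [folklore] **THE CAPACITANCE SOLUTION OF A FIBRE VECTOR.**  For every `v`, with `r := fibreFun (blochChar p) v`, the pair `(v∘inr∘inr, c)` for some gauge
constant `c` solves the capacitance system with the sources of `r`, and the amplitudes of `v` ARE leaf-15's per-alias formulas at that solution. -/
theorem cap_solution (p : Fin D → ℂ) (hL : ∀ m : TorusSite D N, lapSym (kFine p m) ≠ 0) (v : Idx D N → ℂ) :
    ∃ c : ℂ, CapSolves (aliasFibre p hL) (srcEL p (fibreFun (⇑(blochChar p)) v)) (srcG p (fibreFun (⇑(blochChar p)) v))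
        (fibreFun (⇑(blochChar p)) v (Sum.inr (Sum.inl 0))) (fun κ => fibreFun (⇑(blochChar p)) v (Sum.inr (Sum.inr κ)))
        (fun κ => v (Sum.inr (Sum.inr κ))) c ∧
      ampA p v = Ablk (aliasFibre p hL) (srcEL p (fibreFun (⇑(blochChar p)) v)) (srcG p (fibreFun (⇑(blochChar p)) v))
        (fun κ => v (Sum.inr (Sum.inr κ))) c ∧
      ampμ p v = mublk (aliasFibre p hL) (srcEL p (fibreFun (⇑(blochChar p)) v)) (fun κ => v (Sum.inr (Sum.inr κ))) := by
  obtain ⟨c, harr⟩ := (fibreFun_eq_iff_arrowSolves p hL v _).mp rfl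
  obtain ⟨hcap, hA, hμ⟩ := (arrowSolves_iff _ _ _ _ _ _ _ _ _).mp harr
  exact ⟨c, hcap, hA, hμ⟩

/-- [folklore] **THE BORDERED INVERSE** (S1b/S1b′, «arrowMat_inv_apply» in solution form).  If `fibreFun (blochChar p) v = r` and `(φ, c)` is ANY solution of the
capacitance system with the sources of `r` (unique by `cap_unique`), then `φ = v∘inr∘inr` and the box data of `v` are the synthesis of the per-alias formulas:
`v (inl (κ,z)) = Σ_m Ablk … m κ · pw k_m (repZ z)`, `v (inr (inl z)) = Σ_m mublk … m · pw k_m (repZ z)`. -/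
theorem bordered_inverse (p : Fin D → ℂ) (hχ : ∀ a, ‖blochChar p a‖ = 1) (hL : ∀ m : TorusSite D N, lapSym (kFine p m) ≠ 0)
    {v r : Idx D N → ℂ} (hv : fibreFun (⇑(blochChar p)) v = r) {φ : Fin D → ℂ} {c : ℂ}
    (hcap : CapSolves (aliasFibre p hL) (srcEL p r) (srcG p r) (r (Sum.inr (Sum.inl 0))) (fun κ => r (Sum.inr (Sum.inr κ))) φ c) :
    (∀ κ, v (Sum.inr (Sum.inr κ)) = φ κ) ∧
    (∀ κ (z : TorusSite D N), v (Sum.inl (κ, z))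
        = ∑ m : TorusSite D N, Ablk (aliasFibre p hL) (srcEL p r) (srcG p r) φ c m κ * pw (kFine p m) (repZ z)) ∧
    (∀ z : TorusSite D N, v (Sum.inr (Sum.inl z))
        = ∑ m : TorusSite D N, mublk (aliasFibre p hL) (srcEL p r) φ m * pw (kFine p m) (repZ z)) := by
  subst hv
  obtain ⟨c₀, hcap₀, hA, hμ⟩ := cap_solution p hL v
  obtain ⟨hφ, hc⟩ := cap_unique p hχ hL hcap₀ hcap
  subst hφ; subst hc
  refine ⟨fun κ => rfl, fun κ z => ?_, fun z => ?_⟩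
  · rw [boxData_inl_eq_sum p v κ z, hA]
  · rw [boxData_inr_eq_sum p v z, hμ]

/-- [folklore] EXISTENCE: every right-hand side `r` is attained (an2's bijectivity of the fibre map), so the bordered inverse describes
`(fibreMatrix (blochChar p))⁻¹ r` for every `r`. -/
theorem exists_fibreFun_eq (p : Fin D → ℂ) (hχ : ∀ a, ‖blochChar p a‖ = 1) (r : Idx D N → ℂ) :
    ∃ v : Idx D N → ℂ, fibreFun (⇑(blochChar p)) v = r := by
  obtain ⟨v, hv⟩ := (BlochFibreMatrix.fibreLin_bijective (blochChar p) hχ).2 r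
  exact ⟨v, by rw [← fibreLin_apply]; exact hv⟩

/-- [folklore] … and for every `r` the capacitance system with the sources of `r` IS solvable (by the `φ`-slot and gauge constant of that `v`). -/
theorem exists_capSolves (p : Fin D → ℂ) (hχ : ∀ a, ‖blochChar p a‖ = 1) (hL : ∀ m : TorusSite D N, lapSym (kFine p m) ≠ 0) (r : Idx D N → ℂ) :
    ∃ (φ : Fin D → ℂ) (c : ℂ), CapSolves (aliasFibre p hL) (srcEL p r) (srcG p r) (r (Sum.inr (Sum.inl 0))) (fun κ => r (Sum.inr (Sum.inr κ))) φ c := by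
  obtain ⟨v, hv⟩ := exists_fibreFun_eq p hχ r
  obtain ⟨c, hcap, _, _⟩ := cap_solution p hL v
  rw [hv] at hcap
  exact ⟨_, c, hcap⟩

end Alias

end Summit.QuantumFields.BalabanUV.Beta.GAN24.Capacitance

end
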